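import Literature.Analysis.FluidPDE.UniversalTotalAnomalousDissipatorProofs
import HarnessLib

/-!
# Scalar zeroth law over a prescribed carrier — the periodised Hess-Childs–Rowan field

The stirring carrier of `ScalarZerothLawQuant` (cell `ad-ideate`, planner ad-ideate-p1 ROUND-10
§B2): from the field `V` of Hess-Childs–Rowan (class `HessChildsRowan2025a.IsCarrier α V`) and the
forward–backward field `W = HessChildsRowan2025a.forwardBackwardField V` of their Definition 1.2
(supported in `t ∈ [1/4, 3/4]`), the `L`-periodic carrier

  `b_L(t, x) = W(L · fract(t/L), x)`   (written `fun t x => W (Int.fract (t / L) * L) x`),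

active on `[nL, nL + 1]` and silent on the quiet part `[nL + 1, (n+1)L]` of every period.

* `forwardBackwardField_eq_smul` — at every time `W(t) = c • V(s)` with `0 ≤ c ≤ 8`; hence `W`
  (and `b_L`) is bounded by `8A`, `α`-Hölder in space with constant `8A`, and weakly divergence
  free at every time (`isWeaklyDivFree_smul`);
* `fract_div_mul_*` — the periodisation: `L`-periodicity, `b_L = W` on `[0, L)` and on every
  translate `nL + [0, L)`, and `b_L = 0` on `[nL + 1, (n+1)L]` (`n : ℤ`);
* `aestronglyMeasurable_stLift_forwardBackwardField`, `aestronglyMeasurable_stLift_periodize` —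
  space–time measurability (the time reparametrisations `t ↦ 4t - 1`, `t ↦ 3 - 4t`,
  `t ↦ L·fract(t/L)` are quasi-measure-preserving).

Supports stmt-AnomalousDissipation-0448 (prescribed-carrier rung; no statement about Navier–Stokes).
-/

noncomputable section

-- `Summit.<Summit>.<Problem>` is the tree's mandated summit-side namespace (CONVENTIONS §2); for this
-- single-conjunct summit the two coincide, so the duplicate is deliberate.
set_option linter.dupNamespace false

namespace Summit.AnomalousDissipation.AnomalousDissipation.Theorems.ScalarZerothLawKinematic

open MeasureTheory Set Filter Topology
open scoped NNReal ENNReal InnerProductSpace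
open Literature.Analysis Literature.Analysis.FluidPDE Literature.Analysis.FunctionSpaces
open Literature.Analysis.FluidPDE.HessChildsRowan2025a

variable {α : ℝ≥0} {V : ℝ → UnitAddTorus (Fin 2) → EuclideanSpace ℝ (Fin 2)}

/-! ## The forward–backward field is a bounded multiple of a slice of `V` -/

/-- At every time the forward–backward field of Def. 1.2 is a multiple `c • V(s)` of a slice of
`V`, with `0 ≤ c ≤ 8` (`c = 0` outside `[1/4, 3/4]`, `4` inside, `8` at the junction `t = 1/2`). -/
theorem forwardBackwardField_eq_smul (V : ℝ → UnitAddTorus (Fin 2) → EuclideanSpace ℝ (Fin 2)) (t : ℝ) :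
    ∃ c s : ℝ, 0 ≤ c ∧ c ≤ 8 ∧ forwardBackwardField V t = c • V s := by
  rcases lt_or_ge t (1 / 4) with h1 | h1
  · refine ⟨0, 0, le_rfl, by norm_num, funext fun x => ?_⟩
    rw [forwardBackwardField_eq_zero_of_lt h1]; simp
  rcases lt_trichotomy t (1 / 2) with h2 | h2 | h2
  · refine ⟨4, 4 * t - 1, by norm_num, by norm_num, funext fun x => ?_⟩
    rw [forwardBackwardField_of_mem_Ico ⟨h1, h2⟩]; rfl
  · subst h2
    refine ⟨8, 1, by norm_num, le_rfl, funext fun x => ?_⟩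
    rw [forwardBackwardField_half]; rfl
  rcases le_or_gt t (3 / 4) with h3 | h3
  · refine ⟨4, 3 - 4 * t, by norm_num, by norm_num, funext fun x => ?_⟩
    rw [forwardBackwardField_of_mem_Ioc ⟨h2, h3⟩]; rfl
  · refine ⟨0, 0, le_rfl, by norm_num, funext fun x => ?_⟩
    rw [forwardBackwardField_eq_zero_of_gt h3]; simp

/-- Scalar multiples of weakly divergence-free fields are weakly divergence free. -/
theorem isWeaklyDivFree_smul {d : Type*} [Fintype d] {u : UnitAddTorus d → EuclideanSpace ℝ d}
    (hu : Torus.IsWeaklyDivFree u) (c : ℝ) : Torus.IsWeaklyDivFree (c • u) := by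
  intro θ hθ
  have e : (fun x => ⟪(c • u) x, Torus.gradient θ x⟫_ℝ) = fun x => c * ⟪u x, Torus.gradient θ x⟫_ℝ := by
    funext x; simp [real_inner_smul_left]
  rw [e, integral_const_mul, hu θ hθ, mul_zero]

/-- The forward–backward field is bounded by `8A` when `V` is bounded by `A`. -/
theorem norm_forwardBackwardField_le {A : ℝ} (hA : ∀ (t : ℝ) (x : UnitAddTorus (Fin 2)), ‖V t x‖ ≤ A)
    (t : ℝ) (x : UnitAddTorus (Fin 2)) : ‖forwardBackwardField V t x‖ ≤ 8 * A := by
  obtain ⟨c, s, hc0, hc8, he⟩ := forwardBackwardField_eq_smul V t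
  have hA0 : 0 ≤ A := (norm_nonneg _).trans (hA 0 x)
  rw [he, Pi.smul_apply, norm_smul, Real.norm_eq_abs, abs_of_nonneg hc0]
  exact mul_le_mul hc8 (hA s x) (norm_nonneg _) (by norm_num)

/-- The forward–backward field is `α`-Hölder in space with constant `8A` at every time when `V` is
`α`-Hölder with constant `A` at every time. -/
theorem holderWith_forwardBackwardField {A : ℝ≥0} (hH : ∀ t : ℝ, HolderWith A α (V t)) (t : ℝ) :
    HolderWith (8 * A) α (forwardBackwardField V t) := by
  obtain ⟨c, s, hc0, hc8, he⟩ := forwardBackwardField_eq_smul V t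
  rw [he]
  refine ((hH s).smul c).mono ?_
  have : ‖c‖₊ ≤ 8 := by
    rw [← NNReal.coe_le_coe, coe_nnnorm, Real.norm_eq_abs, abs_of_nonneg hc0]; exact_mod_cast hc8
  calc A * ‖c‖₊ ≤ A * 8 := by gcongr
    _ = 8 * A := mul_comm _ _

/-- The forward–backward field is weakly divergence free at every time when `V` is. -/
theorem isWeaklyDivFree_forwardBackwardField (hdiv : ∀ t : ℝ, Torus.IsWeaklyDivFree (V t)) (t : ℝ) :
    Torus.IsWeaklyDivFree (forwardBackwardField V t) := by
  obtain ⟨c, s, -, -, he⟩ := forwardBackwardField_eq_smul V t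
  rw [he]
  exact isWeaklyDivFree_smul (hdiv s) c

/-! ## The periodisation `t ↦ L · fract(t/L)` -/

/-- `L · fract(t/L)` is `L`-periodic. -/
theorem fract_div_mul_add_period {L : ℝ} (hL : L ≠ 0) (t : ℝ) :
    Int.fract ((t + L) / L) * L = Int.fract (t / L) * L := by
  rw [add_div, div_self hL, Int.fract_add_one]

/-- On `[0, L)` the periodisation is the identity. -/
theorem fract_div_mul_of_mem_Ico {L t : ℝ} (hL : 0 < L) (ht : t ∈ Ico 0 L) :
    Int.fract (t / L) * L = t := by
  have h : Int.fract (t / L) = t / L :=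
    Int.fract_eq_self.2 ⟨div_nonneg ht.1 hL.le, (div_lt_one hL).2 ht.2⟩
  rw [h, div_mul_cancel₀ t hL.ne']

/-- On the translate `nL + [0, L)` (`n : ℤ`) the periodisation subtracts `nL`. -/
theorem fract_div_mul_intCast_mul_add {L t : ℝ} (hL : 0 < L) (n : ℤ) (ht : t ∈ Ico 0 L) :
    Int.fract (((n : ℝ) * L + t) / L) * L = t := by
  rw [add_div, mul_div_cancel_right₀ _ hL.ne', add_comm, Int.fract_add_intCast]
  exact fract_div_mul_of_mem_Ico hL ht

/-- On the translate `nL + [0, L)` (`n : ℕ`) the periodisation subtracts `nL`. -/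
theorem fract_div_mul_natCast_mul_add {L t : ℝ} (hL : 0 < L) (n : ℕ) (ht : t ∈ Ico 0 L) :
    Int.fract (((n : ℝ) * L + t) / L) * L = t := by
  have := fract_div_mul_intCast_mul_add hL (n : ℤ) ht
  simpa using this

/-- **The quiet phase.** For `nL + 1 ≤ t ≤ (n+1)L` (`n : ℤ`, `L > 0`) the periodised time
`L · fract(t/L)` is either `0` or `≥ 1`, so the forward–backward field (supported in `[1/4, 3/4]`)
vanishes there: `W(L · fract(t/L)) = 0`. -/
theorem forwardBackwardField_fract_eq_zero {L : ℝ} (hL : 0 < L) (n : ℤ) {t : ℝ}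
    (h1 : (n : ℝ) * L + 1 ≤ t) (h2 : t ≤ ((n : ℝ) + 1) * L) :
    forwardBackwardField V (Int.fract (t / L) * L) = 0 := by
  funext x
  rcases h2.lt_or_eq with hlt | heq
  · -- `⌊t/L⌋ = n`, `fract(t/L) · L = t - nL ≥ 1 > 3/4`
    have hfloor : ⌊t / L⌋ = n := by
      rw [Int.floor_eq_iff]
      constructor
      · rw [le_div_iff₀ hL]; nlinarith
      · rw [div_lt_iff₀ hL]; linarith
    have hfr : Int.fract (t / L) * L = t - n * L := by
      rw [← Int.self_sub_floor, hfloor, sub_mul, div_mul_cancel₀ t hL.ne']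
    rw [hfr]
    exact forwardBackwardField_eq_zero_of_gt (by linarith) x
  · -- `t = (n+1)L`: `fract = 0`
    have hfr : Int.fract (t / L) = 0 := by
      rw [heq, mul_div_cancel_right₀ _ hL.ne']
      have : ((n : ℝ) + 1) = ((n + 1 : ℤ) : ℝ) := by push_cast; ring
      rw [this, Int.fract_intCast]
    rw [hfr, zero_mul]
    exact forwardBackwardField_eq_zero_of_lt (by norm_num) x

/-! ## Space–time measurability -/

/-- An affine time reparametrisation `t ↦ a t + c` (`a ≠ 0`) is quasi-measure-preserving on `ℝ`. -/
theorem quasiMeasurePreserving_affine {a c : ℝ} (ha : a ≠ 0) :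
    Measure.QuasiMeasurePreserving (fun t : ℝ => a * t + c) volume volume := by
  have h1 : Measure.QuasiMeasurePreserving (fun t : ℝ => a * t) volume volume := by
    refine ⟨measurable_const_mul a, ?_⟩
    rw [Real.map_volume_mul_left ha]
    exact Measure.smul_absolutelyContinuous
  have h2 : Measure.QuasiMeasurePreserving (fun t : ℝ => t + c) volume volume :=
    (measurePreserving_add_right volume c).quasiMeasurePreserving
  exact h2.comp h1

/-- The periodisation `t ↦ L · fract(t/L)` (`L ≠ 0`) is quasi-measure-preserving on `ℝ`: the
preimage of a null set is contained in the countable union of its translates by `nL`. -/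
theorem quasiMeasurePreserving_fract_div_mul {L : ℝ} (hL : L ≠ 0) :
    Measure.QuasiMeasurePreserving (fun t : ℝ => Int.fract (t / L) * L) volume volume := by
  have hmeas : Measurable fun t : ℝ => Int.fract (t / L) * L :=
    (measurable_fract.comp (measurable_id.div_const L)).mul_const L
  refine ⟨hmeas, Measure.AbsolutelyContinuous.mk fun s hs h0 => ?_⟩
  rw [Measure.map_apply hmeas hs]
  have hsub : (fun t : ℝ => Int.fract (t / L) * L) ⁻¹' s ⊆
      ⋃ n : ℤ, (fun t : ℝ => t + (-((n : ℝ) * L))) ⁻¹' s := by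
    intro t ht
    simp only [mem_preimage] at ht
    refine mem_iUnion.2 ⟨⌊t / L⌋, ?_⟩
    simp only [mem_preimage]
    have e : Int.fract (t / L) * L = t + -((⌊t / L⌋ : ℝ) * L) := by
      rw [← Int.self_sub_floor, sub_mul, div_mul_cancel₀ t hL]; ring
    rwa [e] at ht
  refine measure_mono_null hsub (measure_iUnion_null fun n => ?_)
  rw [measure_preimage_add_right]
  exact h0

/-- **Space–time measurability of the forward–backward field**: if the lift of `V` is a.e.
strongly measurable on `ℝ × ℝ²`, so is the lift of `W` (indicators of the two time slabs times
`V` composed with the quasi-measure-preserving maps `(t,y) ↦ (4t-1, y)`, `(t,y) ↦ (3-4t, y)`). -/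
theorem aestronglyMeasurable_stLift_forwardBackwardField
    (hV : AEStronglyMeasurable (Torus.stLift V) volume) :
    AEStronglyMeasurable (Torus.stLift (forwardBackwardField V)) volume := by
  have hvol : (volume : Measure (ℝ × EuclideanSpace ℝ (Fin 2))) =
      (volume : Measure ℝ).prod (volume : Measure (EuclideanSpace ℝ (Fin 2))) := rfl
  have hΨ : ∀ {a c : ℝ}, a ≠ 0 → Measure.QuasiMeasurePreserving
      (Prod.map (fun t : ℝ => a * t + c) (id : EuclideanSpace ℝ (Fin 2) → EuclideanSpace ℝ (Fin 2)))
      volume volume := by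
    intro a c ha
    rw [hvol]
    exact MeasureTheory.QuasiMeasurePreserving.prodMap (quasiMeasurePreserving_affine ha)
      (Measure.QuasiMeasurePreserving.id volume)
  have hF' : AEStronglyMeasurable (fun p : ℝ × EuclideanSpace ℝ (Fin 2) =>
      Torus.stLift V (4 * p.1 + (-1), p.2)) volume :=
    hV.comp_quasiMeasurePreserving (hΨ (a := 4) (c := -1) (by norm_num))
  have hB' : AEStronglyMeasurable (fun p : ℝ × EuclideanSpace ℝ (Fin 2) =>
      Torus.stLift V (-4 * p.1 + 3, p.2)) volume :=
    hV.comp_quasiMeasurePreserving (hΨ (a := -4) (c := 3) (by norm_num))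
  have eF : (fun p : ℝ × EuclideanSpace ℝ (Fin 2) => Torus.stLift V (4 * p.1 - 1, p.2)) =
      fun p => Torus.stLift V (4 * p.1 + (-1), p.2) := by
    funext p; rw [sub_eq_add_neg]
  have eB : (fun p : ℝ × EuclideanSpace ℝ (Fin 2) => Torus.stLift V (3 - 4 * p.1, p.2)) =
      fun p => Torus.stLift V (-4 * p.1 + 3, p.2) := by
    funext p; congr 2; ring
  have hF : AEStronglyMeasurable (fun p : ℝ × EuclideanSpace ℝ (Fin 2) =>
      Torus.stLift V (4 * p.1 - 1, p.2)) volume := by rw [eF]; exact hF'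
  have hB : AEStronglyMeasurable (fun p : ℝ × EuclideanSpace ℝ (Fin 2) =>
      Torus.stLift V (3 - 4 * p.1, p.2)) volume := by rw [eB]; exact hB'
  have hS1 : MeasurableSet (Icc (1 / 4 : ℝ) (1 / 2) ×ˢ (univ : Set (EuclideanSpace ℝ (Fin 2)))) :=
    measurableSet_Icc.prod MeasurableSet.univ
  have hS2 : MeasurableSet (Icc (1 / 2 : ℝ) (3 / 4) ×ˢ (univ : Set (EuclideanSpace ℝ (Fin 2)))) :=
    measurableSet_Icc.prod MeasurableSet.univ
  have key : Torus.stLift (forwardBackwardField V) =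
      (Icc (1 / 4 : ℝ) (1 / 2) ×ˢ univ).indicator (fun p => (4 : ℝ) • Torus.stLift V (4 * p.1 - 1, p.2)) +
      (Icc (1 / 2 : ℝ) (3 / 4) ×ˢ univ).indicator (fun p => (4 : ℝ) • Torus.stLift V (3 - 4 * p.1, p.2)) := by
    funext p
    obtain ⟨t, y⟩ := p
    simp only [Torus.stLift_apply, forwardBackwardField, Pi.add_apply, Set.indicator, mem_prod, mem_univ,
      and_true]
  rw [key]
  exact ((hF.const_smul (4 : ℝ)).indicator hS1).add ((hB.const_smul (4 : ℝ)).indicator hS2)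

/-- **Space–time measurability of the periodised field** `(t, x) ↦ W(L · fract(t/L), x)`
(`L ≠ 0`), for any field `W` whose lift is a.e. strongly measurable on `ℝ × ℝ²`. -/
theorem aestronglyMeasurable_stLift_periodize {W : ℝ → UnitAddTorus (Fin 2) → EuclideanSpace ℝ (Fin 2)}
    (hW : AEStronglyMeasurable (Torus.stLift W) volume) {L : ℝ} (hL : L ≠ 0) :
    AEStronglyMeasurable (Torus.stLift fun t x => W (Int.fract (t / L) * L) x) volume := by
  have hvol : (volume : Measure (ℝ × EuclideanSpace ℝ (Fin 2))) =
      (volume : Measure ℝ).prod (volume : Measure (EuclideanSpace ℝ (Fin 2))) := rfl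
  have hΦ : Measure.QuasiMeasurePreserving
      (Prod.map (fun t : ℝ => Int.fract (t / L) * L) (id : EuclideanSpace ℝ (Fin 2) → EuclideanSpace ℝ (Fin 2)))
      volume volume := by
    rw [hvol]
    exact MeasureTheory.QuasiMeasurePreserving.prodMap (quasiMeasurePreserving_fract_div_mul hL)
      (Measure.QuasiMeasurePreserving.id volume)
  have e : (Torus.stLift fun t x => W (Int.fract (t / L) * L) x) =
      Torus.stLift W ∘ Prod.map (fun t : ℝ => Int.fract (t / L) * L) id := by
    funext p; obtain ⟨t, y⟩ := p; rfl
  rw [e]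
  exact hW.comp_quasiMeasurePreserving hΦ

/-! ## The carrier class of the periodised field -/

/-- **The periodised Hess-Childs–Rowan field is a stirring carrier.** For `V` with
`IsCarrier α V` and `L > 0`, the field `b_L(t) = W(L · fract(t/L))` is space–time measurable,
bounded, `α`-Hölder in space with one constant at every time, weakly divergence free at every
time, and `L`-periodic — with the SAME constant `8A` for the bound and the Hölder modulus. -/
theorem periodize_carrier (hV : IsCarrier α V) {L : ℝ} (hL : 0 < L) :
    AEStronglyMeasurable (Torus.stLift fun t x => forwardBackwardField V (Int.fract (t / L) * L) x) volume ∧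
    (∃ A : ℝ≥0, (∀ (t : ℝ) (x : UnitAddTorus (Fin 2)), ‖forwardBackwardField V (Int.fract (t / L) * L) x‖ ≤ A) ∧
      ∀ t : ℝ, HolderWith A α (forwardBackwardField V (Int.fract (t / L) * L))) ∧
    (∀ t : ℝ, Torus.IsWeaklyDivFree (forwardBackwardField V (Int.fract (t / L) * L))) ∧
    (∀ t : ℝ, (fun t x => forwardBackwardField V (Int.fract (t / L) * L) x) (t + L) =
      (fun t x => forwardBackwardField V (Int.fract (t / L) * L) x) t) := by
  obtain ⟨A, hA, hH, -⟩ := hV.exists_const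
  refine ⟨aestronglyMeasurable_stLift_periodize (aestronglyMeasurable_stLift_forwardBackwardField
    hV.aestronglyMeasurable) hL.ne', ⟨8 * A, fun t x => ?_, fun t => holderWith_forwardBackwardField hH _⟩,
    fun t => isWeaklyDivFree_forwardBackwardField hV.isWeaklyDivFree _, fun t => ?_⟩
  · have := norm_forwardBackwardField_le (V := V) (A := (A : ℝ)) hA (Int.fract (t / L) * L) x
    exact_mod_cast this
  · funext x
    simp only [fract_div_mul_add_period hL.ne']

end Summit.AnomalousDissipation.AnomalousDissipation.Theorems.ScalarZerothLawKinematic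

end
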